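import Summits.HubbardSuperconductivity.HubbardSuperconductivity.Theorems.ThermalWedgeTwTipContinuationEdgeOrderFreeBound
import Summits.HubbardSuperconductivity.HubbardSuperconductivity.Theorems.ThermalWedgeTwTipContinuationEdgeOrderPairAlgebra
import Summits.HubbardSuperconductivity.HubbardSuperconductivity.Theorems.ThermalWedgeTwTipContinuationEdgeOrderPairCommutators
import Summits.HubbardSuperconductivity.HubbardSuperconductivity.Theorems.ThermalWedgeTwTipContinuationEdgeOrderTorusTrig
import Literature.MathematicalPhysics.QuantumLattice.ApproximateEigenvectorLemmas

/-!
# `TwTipContinuation` (stmt-HubbardSuperconductivity-1700), line `isogap-submodular-transport`,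
# stub `stub_edgeOrder` — piece 3a(iv): the pair-addition cost of the seeded free torus

For the seeded `U = 0` torus `H = hubbardTorus 2 L 1 0 − (c/L²)(Δ_dᴴ Δ_d)` (`c ≥ 0`, `L ≥ 3`) the
sector energies `E(2m) = minEnergyOn H (szSector (2m) 0)` satisfy the **pair-addition bound**
`E(2m+2) ≤ E(2m) + 8 + c (C_d/2 + 256)` for `2m ≤ L²` (`C_d` the constant of
`expect_pairIntensity_le`): average the Rayleigh quotients of the `L⁴` trial vectors
`c†_{k↑} c†_{q↓} ψ` (`ψ` a unit sector ground state), whose squared norms total `(L² − m)² ≥ L⁴/4`,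
and bound `⟨c†c†ψ, [H, c†c†]ψ⟩` by the one-body commutator (`≤ 8‖·‖²`) plus a Cauchy–Schwarz /
AM–GM estimate of the seed commutator (`‖Δ_d φ‖² ≤ C_d L⁴‖φ‖²`, `‖[Δ_d, c†c†]ψ‖² ≤ 128`).
Folklore (stability of BCS-type mean-field energies under adding a pair).
-/

noncomputable section

namespace Summit.HubbardSuperconductivity.TwTipContinuation.IsogapTransport

open Matrix Finset
open Literature.MathematicalPhysics.QuantumLattice Literature.Probability.LatticeModels
open Summit.HubbardSuperconductivity.TwTipContinuation.Negative
open scoped ComplexOrder ComplexConjugate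

/-! ### Elementary Hilbert-space inequalities in `dotProduct` form -/

section Hilbert

variable {n : Type*} [Fintype n]

/-- `re⟨b, a⟩ = re⟨a, b⟩`. [folklore] -/
theorem re_star_dotProduct_comm (a b : n → ℂ) : (star b ⬝ᵥ a).re = (star a ⬝ᵥ b).re := by
  rw [star_dotProduct, Complex.star_def, Complex.conj_re]

/-- **Polarised AM–GM**: `−2 re⟨a,b⟩ ≤ s² ‖a‖² + r² ‖b‖²` whenever `s r = 1` (`s, r` real). [folklore] -/
theorem neg_two_mul_re_le (a b : n → ℂ) {s r : ℝ} (hsr : s * r = 1) :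
    -(2 * (star a ⬝ᵥ b).re) ≤ s ^ 2 * (star a ⬝ᵥ a).re + r ^ 2 * (star b ⬝ᵥ b).re := by
  have h0 := (Complex.nonneg_iff.1 (dotProduct_star_self_nonneg ((s : ℂ) • a + (r : ℂ) • b))).1
  rw [star_add, star_smul, star_smul, add_dotProduct, smul_dotProduct, smul_dotProduct, dotProduct_add, dotProduct_add,
    dotProduct_smul, dotProduct_smul, dotProduct_smul, dotProduct_smul] at h0
  simp only [Complex.star_def, Complex.conj_ofReal, smul_eq_mul, Complex.add_re, Complex.re_ofReal_mul,
    re_star_dotProduct_comm b a] at h0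
  have he : s * (s * (star a ⬝ᵥ a).re + r * (star b ⬝ᵥ a).re) + r * (s * (star b ⬝ᵥ a).re + r * (star b ⬝ᵥ b).re) =
      s ^ 2 * (star a ⬝ᵥ a).re + r ^ 2 * (star b ⬝ᵥ b).re + 2 * (s * r) * (star b ⬝ᵥ a).re := by ring
  rw [he, hsr, re_star_dotProduct_comm a b] at h0
  linarith

/-- Scaling a quadratic form: `re⟨c x, M (c x)⟩ = ‖c‖² re⟨x, M x⟩`. [folklore] -/
theorem re_star_smul_dotProduct_mulVec_smul (M : Matrix n n ℂ) (c : ℂ) (x : n → ℂ) :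
    (star (c • x) ⬝ᵥ (M *ᵥ (c • x))).re = ‖c‖ ^ 2 * (star x ⬝ᵥ (M *ᵥ x)).re := by
  rw [mulVec_smul, star_smul, smul_dotProduct, dotProduct_smul, smul_eq_mul, smul_eq_mul, ← mul_assoc,
    Complex.star_def, Complex.conj_mul', ← Complex.ofReal_pow, Complex.re_ofReal_mul]

/-- Scaling the norm: `re⟨c x, c x⟩ = ‖c‖² re⟨x, x⟩`. [folklore] -/
theorem re_star_smul_dotProduct_smul (c : ℂ) (x : n → ℂ) :
    (star (c • x) ⬝ᵥ (c • x)).re = ‖c‖ ^ 2 * (star x ⬝ᵥ x).re := by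
  rw [star_smul, smul_dotProduct, dotProduct_smul, smul_eq_mul, smul_eq_mul, ← mul_assoc,
    Complex.star_def, Complex.conj_mul', ← Complex.ofReal_pow, Complex.re_ofReal_mul]

/-- **Homogeneous form of a Rayleigh bound.** A lower bound `E ≤ re⟨v, Mv⟩` on the unit vectors of a
subspace gives `E · re⟨φ,φ⟩ ≤ re⟨φ, Mφ⟩` for every `φ` of the subspace. [folklore] -/
theorem mul_norm_le_of_rayleigh (M : Matrix n n ℂ) (K : Submodule ℂ (n → ℂ)) {E : ℝ}
    (hb : ∀ v ∈ K, star v ⬝ᵥ v = 1 → E ≤ (star v ⬝ᵥ (M *ᵥ v)).re) {φ : n → ℂ} (hφ : φ ∈ K) :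
    E * (star φ ⬝ᵥ φ).re ≤ (star φ ⬝ᵥ (M *ᵥ φ)).re := by
  by_cases hz : φ = 0
  · simp [hz]
  obtain ⟨c, hc, hc1⟩ := exists_smul_unit hz
  have h := hb _ (K.smul_mem c hφ) hc1
  have hn := congrArg Complex.re hc1
  rw [re_star_smul_dotProduct_smul, Complex.one_re] at hn
  rw [re_star_smul_dotProduct_mulVec_smul] at h
  have hpos : 0 < ‖c‖ ^ 2 := by positivity
  have : (star φ ⬝ᵥ φ).re = 1 / ‖c‖ ^ 2 := by field_simp; linarith
  rw [this, mul_one_div, div_le_iff₀ hpos]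
  linarith

/-- **Homogeneous form of a Rayleigh upper bound** `re⟨v, Mv⟩ ≤ B` on unit vectors:
`re⟨φ, Mφ⟩ ≤ B · re⟨φ,φ⟩` for every `φ`. [folklore] -/
theorem rayleigh_le_mul_norm (M : Matrix n n ℂ) {B : ℝ} (hb : ∀ v : n → ℂ, star v ⬝ᵥ v = 1 → (star v ⬝ᵥ (M *ᵥ v)).re ≤ B)
    (φ : n → ℂ) : (star φ ⬝ᵥ (M *ᵥ φ)).re ≤ B * (star φ ⬝ᵥ φ).re := by
  by_cases hz : φ = 0
  · simp [hz]
  obtain ⟨c, hc, hc1⟩ := exists_smul_unit hz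
  have h := hb _ hc1
  have hn := congrArg Complex.re hc1
  rw [re_star_smul_dotProduct_smul, Complex.one_re] at hn
  rw [re_star_smul_dotProduct_mulVec_smul] at h
  have hpos : 0 < ‖c‖ ^ 2 := by positivity
  have : (star φ ⬝ᵥ φ).re = 1 / ‖c‖ ^ 2 := by field_simp; linarith
  rw [this, mul_one_div, le_div_iff₀ hpos]
  linarith

end Hilbert

/-! ### Norm bounds on the torus -/

section Torus

variable {L : ℕ} [NeZero L]

/-- `‖Δ_d φ‖² ≤ C_d L⁴ ‖φ‖²` for every Fock vector. [folklore] -/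
theorem normSq_pairField_mulVec_le (φ : Fock (Orb (FermionTorus 2 L))) :
    (star (pairField dWaveFormFactor L *ᵥ φ) ⬝ᵥ (pairField dWaveFormFactor L *ᵥ φ)).re ≤
      (∑ e ∈ insert 0 unitSteps, ‖((dWaveFormFactor e / Real.sqrt 2 : ℝ) : ℂ)‖ * 2) ^ 2 * (L : ℝ) ^ 4 *
        (star φ ⬝ᵥ φ).re := by
  rw [← PosSemidefTrace.expect_conjTranspose_mul]
  exact rayleigh_le_mul_norm _ (fun v hv => expect_pairIntensity_le L v hv) φ

/-- The Bloch modes are contractions: `‖c_{kσ} x‖² ≤ ‖x‖²`. [folklore] -/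
theorem normSq_momentumAnnihilation_mulVec_le (k : TorusSite 2 L) (σ : Fin 2) (x : Fock (Orb (FermionTorus 2 L))) :
    (star (momentumAnnihilation k σ *ᵥ x) ⬝ᵥ (momentumAnnihilation k σ *ᵥ x)).re ≤ (star x ⬝ᵥ x).re := by
  rw [← PosSemidefTrace.expect_conjTranspose_mul, momentumAnnihilation_conjTranspose, ← momentumNumber]
  exact re_expect_momentumNumber_le k σ x

/-- `‖c†_{kσ} x‖² ≤ ‖x‖²`. [folklore] -/
theorem normSq_momentumCreation_mulVec_le (k : TorusSite 2 L) (σ : Fin 2) (x : Fock (Orb (FermionTorus 2 L))) :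
    (star (momentumCreation k σ *ᵥ x) ⬝ᵥ (momentumCreation k σ *ᵥ x)).re ≤ (star x ⬝ᵥ x).re := by
  rw [← PosSemidefTrace.expect_conjTranspose_mul, momentumCreation_conjTranspose, ← one_sub_momentumNumber,
    Literature.MathematicalPhysics.QuantumLattice.expect, sub_mulVec, one_mulVec, dotProduct_sub, Complex.sub_re]
  have := re_expect_momentumNumber_nonneg k σ x
  rw [Literature.MathematicalPhysics.QuantumLattice.expect] at this
  linarith

/-- `eucNorm` versions: `‖c_{kσ} x‖ ≤ ‖x‖`. [folklore] -/
theorem eucNorm_momentumAnnihilation_mulVec_le (k : TorusSite 2 L) (σ : Fin 2) (x : Fock (Orb (FermionTorus 2 L))) :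
    eucNorm (momentumAnnihilation k σ *ᵥ x) ≤ eucNorm x := by
  have h := normSq_momentumAnnihilation_mulVec_le k σ x
  rw [← eucNorm_sq, ← eucNorm_sq] at h
  exact (pow_le_pow_iff_left₀ (eucNorm_nonneg _) (eucNorm_nonneg _) two_ne_zero).1 h

/-- `‖c†_{kσ} x‖ ≤ ‖x‖`. [folklore] -/
theorem eucNorm_momentumCreation_mulVec_le (k : TorusSite 2 L) (σ : Fin 2) (x : Fock (Orb (FermionTorus 2 L))) :
    eucNorm (momentumCreation k σ *ᵥ x) ≤ eucNorm x := by
  have h := normSq_momentumCreation_mulVec_le k σ x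
  rw [← eucNorm_sq, ← eucNorm_sq] at h
  exact (pow_le_pow_iff_left₀ (eucNorm_nonneg _) (eucNorm_nonneg _) two_ne_zero).1 h

/-- **The seed commutator is bounded**: `‖[Δ_d, c†_{k↑}c†_{q↓}] ψ‖² ≤ 128` for a unit `ψ`. [folklore] -/
theorem normSq_pairField_commutator_mulVec_le (k q : TorusSite 2 L) {ψ : Fock (Orb (FermionTorus 2 L))}
    (hψ1 : star ψ ⬝ᵥ ψ = 1) :
    (star ((pairField dWaveFormFactor L * (momentumCreation k 0 * momentumCreation q 1) -
        (momentumCreation k 0 * momentumCreation q 1) * pairField dWaveFormFactor L) *ᵥ ψ) ⬝ᵥ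
      ((pairField dWaveFormFactor L * (momentumCreation k 0 * momentumCreation q 1) -
        (momentumCreation k 0 * momentumCreation q 1) * pairField dWaveFormFactor L) *ᵥ ψ)).re ≤ 128 := by
  rw [← eucNorm_sq, pairField_commutator_pairCreator]
  have hψ : eucNorm ψ = 1 := eucNorm_eq_one hψ1
  have hY1 : eucNorm ((momentumAnnihilation (-k) 1 * momentumCreation q 1) *ᵥ ψ) ≤ 1 := by
    rw [← mulVec_mulVec]
    exact ((eucNorm_momentumAnnihilation_mulVec_le _ _ _).trans (eucNorm_momentumCreation_mulVec_le _ _ _)).trans hψ.le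
  have hY2 : eucNorm ((momentumCreation k 0 * momentumAnnihilation (-q) 0) *ᵥ ψ) ≤ 1 := by
    rw [← mulVec_mulVec]
    exact ((eucNorm_momentumCreation_mulVec_le _ _ _).trans (eucNorm_momentumAnnihilation_mulVec_le _ _ _)).trans hψ.le
  have hg1 : ‖((dWaveGap k : ℝ) : ℂ)‖ ≤ 2 := by rw [Complex.norm_real, Real.norm_eq_abs]; exact abs_dWaveGap_le k
  have hg2 : ‖((dWaveGap (-q) : ℝ) : ℂ)‖ ≤ 2 := by rw [Complex.norm_real, Real.norm_eq_abs]; exact abs_dWaveGap_le (-q)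
  have hs : ‖((2 * Real.sqrt 2 : ℝ) : ℂ)‖ = 2 * Real.sqrt 2 := by
    rw [Complex.norm_real, Real.norm_eq_abs, abs_of_nonneg (by positivity)]
  have hle : eucNorm (-(((2 * Real.sqrt 2 : ℝ) : ℂ) •
      (((dWaveGap k : ℝ) : ℂ) • ((momentumAnnihilation (-k) 1 * momentumCreation q 1) *ᵥ ψ) -
        ((dWaveGap (-q) : ℝ) : ℂ) • ((momentumCreation k 0 * momentumAnnihilation (-q) 0) *ᵥ ψ)))) ≤
      2 * Real.sqrt 2 * (2 * 1 + 2 * 1) := by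
    rw [eucNorm_neg, eucNorm_smul, hs]
    gcongr
    refine (eucNorm_sub_le _ _).trans (add_le_add ?_ ?_)
    · rw [eucNorm_smul]; exact mul_le_mul hg1 hY1 (eucNorm_nonneg _) zero_le_two
    · rw [eucNorm_smul]; exact mul_le_mul hg2 hY2 (eucNorm_nonneg _) zero_le_two
  rw [neg_mulVec, smul_mulVec, sub_mulVec, smul_mulVec, smul_mulVec]
  have hnn := eucNorm_nonneg (-(((2 * Real.sqrt 2 : ℝ) : ℂ) •
      (((dWaveGap k : ℝ) : ℂ) • ((momentumAnnihilation (-k) 1 * momentumCreation q 1) *ᵥ ψ) -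
        ((dWaveGap (-q) : ℝ) : ℂ) • ((momentumCreation k 0 * momentumAnnihilation (-q) 0) *ᵥ ψ))))
  have hsq : (2 * Real.sqrt 2 * (2 * 1 + 2 * 1)) ^ 2 = 128 := by
    rw [mul_pow, mul_pow, Real.sq_sqrt zero_le_two]; norm_num
  calc _ ≤ (2 * Real.sqrt 2 * (2 * 1 + 2 * 1)) ^ 2 := pow_le_pow_left₀ hnn hle 2
    _ = 128 := hsq

/-! ### The pair-addition cost -/

omit [NeZero L] in
/-- `H (A ψ) = E (A ψ) + [H, A] ψ` for an eigenvector `H ψ = E ψ`. [folklore] -/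
theorem mulVec_mulVec_of_eigenvector {H A : Matrix (Finset (Orb (FermionTorus 2 L))) (Finset (Orb (FermionTorus 2 L))) ℂ}
    {ψ : Fock (Orb (FermionTorus 2 L))} {E : ℂ} (h : H *ᵥ ψ = E • ψ) :
    H *ᵥ (A *ᵥ ψ) = E • (A *ᵥ ψ) + (H * A - A * H) *ᵥ ψ := by
  rw [sub_mulVec, ← mulVec_mulVec, ← mulVec_mulVec, h, mulVec_smul]
  abel

/-- **One trial vector.** For a unit sector ground state `ψ` of the seeded torus at `(2m, 0)` and the
trial vector `φ = c†_{k↑} c†_{q↓} ψ` of the sector `(2m+2, 0)`: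
`E(2m+2) ‖φ‖² ≤ (E(2m) + 8 + c C_d/2) ‖φ‖² + 64 c`. [folklore] -/
theorem pairAddition_term (hL : 3 ≤ L) {c : ℝ} (hc : 0 ≤ c) {m : ℕ}
    (hm1 : m + 1 ≤ Fintype.card (FermionTorus 2 L)) {ψ : Fock (Orb (FermionTorus 2 L))} (hψ1 : star ψ ⬝ᵥ ψ = 1)
    (hgs : IsGroundStateInSector (hubbardTorus 2 L 1 0 - ((c / (L : ℝ) ^ 2 : ℝ) : ℂ) • ((pairField dWaveFormFactor L)ᴴ * pairField dWaveFormFactor L)) (2 * m) 0 ψ)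
    (k q : TorusSite 2 L) :
    Matrix.minEnergyOn (hubbardTorus 2 L 1 0 - ((c / (L : ℝ) ^ 2 : ℝ) : ℂ) • ((pairField dWaveFormFactor L)ᴴ * pairField dWaveFormFactor L)) (szSector (2 * (m + 1)) 0) *
        (star ((momentumCreation k 0 * momentumCreation q 1) *ᵥ ψ) ⬝ᵥ ((momentumCreation k 0 * momentumCreation q 1) *ᵥ ψ)).re ≤
      (Matrix.minEnergyOn (hubbardTorus 2 L 1 0 - ((c / (L : ℝ) ^ 2 : ℝ) : ℂ) • ((pairField dWaveFormFactor L)ᴴ * pairField dWaveFormFactor L)) (szSector (2 * m) 0) + 8 +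
          c * (∑ e ∈ insert 0 unitSteps, ‖((dWaveFormFactor e / Real.sqrt 2 : ℝ) : ℂ)‖ * 2) ^ 2 / 2) *
        (star ((momentumCreation k 0 * momentumCreation q 1) *ᵥ ψ) ⬝ᵥ ((momentumCreation k 0 * momentumCreation q 1) *ᵥ ψ)).re +
      64 * c := by
  -- abbreviations
  set H := hubbardTorus 2 L 1 0 - ((c / (L : ℝ) ^ 2 : ℝ) : ℂ) • ((pairField dWaveFormFactor L)ᴴ * pairField dWaveFormFactor L) with hHdef
  set A := momentumCreation k 0 * momentumCreation q 1 with hAdef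
  set Δ := pairField dWaveFormFactor L with hΔdef
  set Cd := (∑ e ∈ insert 0 unitSteps, ‖((dWaveFormFactor e / Real.sqrt 2 : ℝ) : ℂ)‖ * 2) ^ 2 with hCd
  set E := Matrix.minEnergyOn H (szSector (2 * m) 0) with hE
  set E' := Matrix.minEnergyOn H (szSector (2 * (m + 1)) 0) with hE'
  set φ := A *ᵥ ψ with hφ
  have hLpos : (0 : ℝ) < L := Nat.cast_pos.2 (NeZero.pos L)
  -- sectors
  have hsec : IsInSector m m ψ := (mem_szSector_two_mul_zero_iff m ψ).1 hgs.1
  have hφmem : φ ∈ szSector (Λ := FermionTorus 2 L) (2 * (m + 1)) (0 : ℝ) :=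
    (mem_szSector_two_mul_zero_iff (m + 1) φ).2 (isInSector_pairCreator_mulVec k q hsec)
  -- the variational bound in the upper sector
  obtain ⟨-, hb⟩ := seeded_sector_groundState 0 c L hm1
  have hvar : E' * (star φ ⬝ᵥ φ).re ≤ (star φ ⬝ᵥ (H *ᵥ φ)).re :=
    mul_norm_le_of_rayleigh H (szSector (2 * (m + 1)) 0) (fun v hv hv1 => hb v hv hv1) hφmem
  -- `H φ = E φ + [H, A] ψ`
  have hHφ : H *ᵥ φ = (E : ℂ) • φ + (H * A - A * H) *ᵥ ψ := mulVec_mulVec_of_eigenvector hgs.2.2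
  have hcomm := seededH_commutator_pairCreator hL (((c / (L : ℝ) ^ 2 : ℝ) : ℂ)) k q
  rw [← hHdef, ← hAdef, ← hΔdef] at hcomm
  -- expand `re⟨φ, Hφ⟩`
  have e1 : star φ ⬝ᵥ ((Δᴴ * (Δ * A - A * Δ)) *ᵥ ψ) = star (Δ *ᵥ φ) ⬝ᵥ ((Δ * A - A * Δ) *ᵥ ψ) := by
    rw [← mulVec_mulVec, star_dotProduct_conjTranspose_mulVec]
  have hexp : (star φ ⬝ᵥ (H *ᵥ φ)).re = E * (star φ ⬝ᵥ φ).re + (torusBand L k + torusBand L q) * (star φ ⬝ᵥ φ).re -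
      c / (L : ℝ) ^ 2 * (star (Δ *ᵥ φ) ⬝ᵥ ((Δ * A - A * Δ) *ᵥ ψ)).re := by
    rw [hHφ, hcomm, dotProduct_add, dotProduct_smul, sub_mulVec, dotProduct_sub, smul_mulVec, dotProduct_smul,
      smul_mulVec, dotProduct_smul, e1, Complex.add_re, Complex.sub_re, smul_eq_mul, smul_eq_mul, smul_eq_mul,
      Complex.re_ofReal_mul, Complex.re_ofReal_mul, Complex.re_ofReal_mul, ← hφ]
    ring
  -- the three bounds
  have hn0 : 0 ≤ (star φ ⬝ᵥ φ).re := (Complex.nonneg_iff.1 (dotProduct_star_self_nonneg φ)).1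
  have hband : (torusBand L k + torusBand L q) * (star φ ⬝ᵥ φ).re ≤ 8 * (star φ ⬝ᵥ φ).re := by
    have h1 := torusBand_le_four L k
    have h2 := torusBand_le_four L q
    nlinarith
  have hamgm := neg_two_mul_re_le (Δ *ᵥ φ) ((Δ * A - A * Δ) *ᵥ ψ) (s := 1 / L) (r := L) (by field_simp)
  have hΔφ : (star (Δ *ᵥ φ) ⬝ᵥ (Δ *ᵥ φ)).re ≤ Cd * (L : ℝ) ^ 4 * (star φ ⬝ᵥ φ).re := normSq_pairField_mulVec_le φ
  have hX : (star ((Δ * A - A * Δ) *ᵥ ψ) ⬝ᵥ ((Δ * A - A * Δ) *ᵥ ψ)).re ≤ 128 :=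
    normSq_pairField_commutator_mulVec_le k q hψ1
  have hγ : 0 ≤ c / (L : ℝ) ^ 2 := by positivity
  have hseed : -(c / (L : ℝ) ^ 2 * (star (Δ *ᵥ φ) ⬝ᵥ ((Δ * A - A * Δ) *ᵥ ψ)).re) ≤
      c * Cd / 2 * (star φ ⬝ᵥ φ).re + 64 * c := by
    have h1 : -(c / (L : ℝ) ^ 2 * (star (Δ *ᵥ φ) ⬝ᵥ ((Δ * A - A * Δ) *ᵥ ψ)).re) ≤
        c / (L : ℝ) ^ 2 * (((1 / L) ^ 2 * (Cd * (L : ℝ) ^ 4 * (star φ ⬝ᵥ φ).re) + (L : ℝ) ^ 2 * 128) / 2) := by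
      have : -(2 * (star (Δ *ᵥ φ) ⬝ᵥ ((Δ * A - A * Δ) *ᵥ ψ)).re) ≤
          (1 / L) ^ 2 * (Cd * (L : ℝ) ^ 4 * (star φ ⬝ᵥ φ).re) + (L : ℝ) ^ 2 * 128 := by
        refine hamgm.trans (add_le_add ?_ ?_)
        · exact mul_le_mul_of_nonneg_left hΔφ (by positivity)
        · exact mul_le_mul_of_nonneg_left hX (by positivity)
      nlinarith
    have h2 : c / (L : ℝ) ^ 2 * (((1 / L) ^ 2 * (Cd * (L : ℝ) ^ 4 * (star φ ⬝ᵥ φ).re) + (L : ℝ) ^ 2 * 128) / 2) =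
        c * Cd / 2 * (star φ ⬝ᵥ φ).re + 64 * c := by
      field_simp
      ring
    linarith
  rw [hexp] at hvar
  nlinarith

/-- **The pair-addition cost.** For `L ≥ 3`, `c ≥ 0` and `2m ≤ L²`, the sector energies of the seeded
`U = 0` torus satisfy `E(2m+2) ≤ E(2m) + 8 + c (C_d/2 + 256)`. [folklore] -/
theorem pairAddition_cost (hL : 3 ≤ L) {c : ℝ} (hc : 0 ≤ c) {m : ℕ} (hm : 2 * m ≤ L ^ 2) :
    Matrix.minEnergyOn (hubbardTorus 2 L 1 0 - ((c / (L : ℝ) ^ 2 : ℝ) : ℂ) • ((pairField dWaveFormFactor L)ᴴ * pairField dWaveFormFactor L)) (szSector (2 * (m + 1)) 0) ≤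
      Matrix.minEnergyOn (hubbardTorus 2 L 1 0 - ((c / (L : ℝ) ^ 2 : ℝ) : ℂ) • ((pairField dWaveFormFactor L)ᴴ * pairField dWaveFormFactor L)) (szSector (2 * m) 0) +
        (8 + c * ((∑ e ∈ insert 0 unitSteps, ‖((dWaveFormFactor e / Real.sqrt 2 : ℝ) : ℂ)‖ * 2) ^ 2 / 2 + 256)) := by
  set Cd := (∑ e ∈ insert 0 unitSteps, ‖((dWaveFormFactor e / Real.sqrt 2 : ℝ) : ℂ)‖ * 2) ^ 2 with hCd
  set E := Matrix.minEnergyOn (hubbardTorus 2 L 1 0 - ((c / (L : ℝ) ^ 2 : ℝ) : ℂ) • ((pairField dWaveFormFactor L)ᴴ * pairField dWaveFormFactor L)) (szSector (2 * m) 0) with hE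
  set E' := Matrix.minEnergyOn (hubbardTorus 2 L 1 0 - ((c / (L : ℝ) ^ 2 : ℝ) : ℂ) • ((pairField dWaveFormFactor L)ᴴ * pairField dWaveFormFactor L)) (szSector (2 * (m + 1)) 0) with hE'
  have hcard : Fintype.card (FermionTorus 2 L) = L ^ 2 := Summit.HubbardSuperconductivity.NoGo.card_fermionTorus_two L
  have hL9 : 9 ≤ L ^ 2 := by nlinarith
  have hm1 : m + 1 ≤ Fintype.card (FermionTorus 2 L) := by rw [hcard]; omega
  have hm0 : m ≤ Fintype.card (FermionTorus 2 L) := by omega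
  obtain ⟨ψ, hψ1, hgs⟩ := exists_unit_groundState 0 c L hm0
  have hsec : IsInSector m m ψ := (mem_szSector_two_mul_zero_iff m ψ).1 hgs.1
  -- sum the per-term inequalities
  have hterm : ∀ k q : TorusSite 2 L,
      E' * (star ((momentumCreation k 0 * momentumCreation q 1) *ᵥ ψ) ⬝ᵥ ((momentumCreation k 0 * momentumCreation q 1) *ᵥ ψ)).re ≤
        (E + 8 + c * Cd / 2) * (star ((momentumCreation k 0 * momentumCreation q 1) *ᵥ ψ) ⬝ᵥ ((momentumCreation k 0 * momentumCreation q 1) *ᵥ ψ)).re +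
          64 * c := by
    intro k q
    have h := pairAddition_term hL hc hm1 hψ1 hgs k q
    rw [← hCd, ← hE, ← hE'] at h
    convert h using 2
  have hsum := Finset.sum_le_sum fun k (_ : k ∈ (Finset.univ : Finset (TorusSite 2 L))) =>
    Finset.sum_le_sum fun q (_ : q ∈ (Finset.univ : Finset (TorusSite 2 L))) => hterm k q
  -- the total squared norm
  have hS : ∑ k : TorusSite 2 L, ∑ q : TorusSite 2 L,
      (star ((momentumCreation k 0 * momentumCreation q 1) *ᵥ ψ) ⬝ᵥ ((momentumCreation k 0 * momentumCreation q 1) *ᵥ ψ)).re =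
      ((L : ℝ) ^ 2 - m) ^ 2 := by
    have h := congrArg Complex.re (sum_normSq_pairCreator_mulVec hsec hψ1)
    rw [Complex.re_sum] at h
    simp only [Complex.re_sum] at h ⊢
    rw [h]
    rw [show ((L : ℂ) ^ 2 - m) ^ 2 = ((((L : ℝ) ^ 2 - m) ^ 2 : ℝ) : ℂ) by push_cast; ring, Complex.ofReal_re]
  simp only [← Finset.sum_mul, ← Finset.mul_sum, Finset.sum_add_distrib, Finset.sum_const, Finset.card_univ,
    card_torusSite_two, nsmul_eq_mul, Nat.cast_pow] at hsum
  rw [hS] at hsum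
  -- `S ≥ L⁴/4 > 0`
  have hmr : 2 * (m : ℝ) ≤ (L : ℝ) ^ 2 := by exact_mod_cast hm
  have hLr : (3 : ℝ) ≤ L := by exact_mod_cast hL
  have hhalf : (L : ℝ) ^ 2 / 2 ≤ (L : ℝ) ^ 2 - m := by linarith
  have hL2 : (9 : ℝ) ≤ (L : ℝ) ^ 2 := by nlinarith
  have hpos1 : 0 < (L : ℝ) ^ 2 - m := by linarith
  have hSpos : 0 < ((L : ℝ) ^ 2 - m) ^ 2 := pow_pos hpos1 2
  have hS4 : (L : ℝ) ^ 2 * (L : ℝ) ^ 2 ≤ 4 * ((L : ℝ) ^ 2 - m) ^ 2 := by nlinarith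
  have h64 : (L : ℝ) ^ 2 * ((L : ℝ) ^ 2 * (64 * c)) ≤ 256 * c * ((L : ℝ) ^ 2 - m) ^ 2 := by nlinarith
  have key : E' * ((L : ℝ) ^ 2 - m) ^ 2 ≤ (E + (8 + c * (Cd / 2 + 256))) * ((L : ℝ) ^ 2 - m) ^ 2 := by
    nlinarith
  exact le_of_mul_le_mul_right key hSpos

/-- **The pair-addition cost (piece 3a(iv) of `stub_edgeOrder`)**, closed form: for `L ≥ 3`, `c ≥ 0`,
`2m ≤ L²`, `E(2m+2) ≤ E(2m) + 8 + c (C_d/2 + 256)` for the seeded `U = 0` torus. [folklore] -/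
theorem pairAddition_cost_bound :
    ∀ (L : ℕ) [NeZero L], 3 ≤ L → ∀ (c : ℝ), 0 ≤ c → ∀ (m : ℕ), 2 * m ≤ L ^ 2 → Matrix.minEnergyOn (hubbardTorus 2 L 1 0 - ((c / (L : ℝ) ^ 2 : ℝ) : ℂ) • ((pairField dWaveFormFactor L)ᴴ * pairField dWaveFormFactor L)) (szSector (2 * (m + 1)) 0) ≤ Matrix.minEnergyOn (hubbardTorus 2 L 1 0 - ((c / (L : ℝ) ^ 2 : ℝ) : ℂ) • ((pairField dWaveFormFactor L)ᴴ * pairField dWaveFormFactor L)) (szSector (2 * m) 0) + (8 + c * ((∑ e ∈ insert 0 unitSteps, ‖((dWaveFormFactor e / Real.sqrt 2 : ℝ) : ℂ)‖ * 2) ^ 2 / 2 + 256)) :=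
  fun _ _ hL _ hc _ hm => pairAddition_cost hL hc hm

end Torus

end Summit.HubbardSuperconductivity.TwTipContinuation.IsogapTransport
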